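import Summits.SmoothPoincare4.SmoothPoincare4.Theorems.CongruenceShadowsNormalFormStablyTrivialLuftDefs

/-!
# Stub `stub_paddingTransfer` of line `luft-twist-reduction` for crux `NormalFormStablyTrivial`
# (item stmt-SmoothPoincare4-14591, route `CongruenceShadows`) — the glue `PaddingTransfer`

Proves the registered stub **`stub_paddingTransfer : PaddingTransfer`** verbatim (`PaddingTransfer`,
`…LuftDefs.lean` §4): `GateAscent → FreePadding → MovesGoeritz → EraseStabilize → GoeritzPadding`.

The argument is bookkeeping through the erasure `e = eraseN1 m : S_{3+3m} ↠ F_{3+3m} = π₁(H₁)`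
(surjective, kernel `N₁`).  Given a gate triple `K` at level `m` (`K₀ = N₀`, `K₁ = N₁`, `π₁ = 1`,
`K₂ = γ N₂` with `γ ∈ Stab N₁`):

* §1 **Lemma A** (shadows of the standard kernels): `e (cutKernel c) = ⟪xⱼ : c j ≠ cPat m 1 j⟫`
  (`map_eraseN1_cutKernel`), whence `e N₂ = P₂`, `e N₀ = P₀` (`map_eraseN1_N_two`,
  `map_eraseN1_N_zero`).
* §2 the automorphism `θ` of `F` INDUCED by `γ` (`γ` stabilises `N₁ = ker e`; first isomorphism
  theorem + `QuotientGroup.congr`): `θ ∘ e = e ∘ γ` (`exists_mulAut_eraseN1`); so the free shadow is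
  `Q = e K₂ = θ P₂`.
* §3 **transversality** `P₀ ⊔ e K₂ = ⊤` from `π₁ = 1` (`P0_sup_map_eraseN1_eq_top`), and the
  read-back: for `L ≤ S` with `e L = v P₂` and a Goeritz element `x` inducing `v`,
  `L ⊔ N₁ = x (N₂ ⊔ N₁)` (`sup_N_one_eq_map_of_map_eraseN1_eq`; both sides contain `ker e = N₁`,
  `Subgroup.comap_map_eq`).
* §4 the stub: take `n := m + 1`; ascend the gate (`GateAscent`); `FreePadding` gives a product `v`
  of padding moves with `v P₂' = ⟪ι Q ∪ new standard generators⟫`; `MovesGoeritz` realises `v` by a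
  Goeritz element `x`; `EraseStabilize` identifies `e' K₂'` with the same normal closure; read back.

References: Luft, Math. Ann. 234 (1978); Abrams–Gay–Kirby, Geom. Topol. 22 (2018);
Zieschang–Vogt–Coldewey, LNM 835 (1980), §3.2.
-/

-- the prescribed namespace `Summit.<P>.<Sub>.…` duplicates `SmoothPoincare4` (P = Sub)
set_option linter.dupNamespace false

noncomputable section

namespace Summit.SmoothPoincare4.SmoothPoincare4.Theorems.NormalFormStablyTrivial.Luft

open Literature.Topology.FourManifolds Subgroup
open Summit.SmoothPoincare4.SmoothPoincare4.Theorems.NormalFormStablyTrivial.Negative (InGate)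

/-! ## §1 Lemma A: the free shadows of the standard kernels -/

/-- **The erasure of a cut kernel**: `e (cutKernel c) = ⟪xⱼ : c j ≠ cPat m 1 j⟫` — the cut letter
of `c` on handle `j` dies under the erasure iff it is the cut letter of slot `1`, and is `xⱼ^{±1}`
otherwise. [folklore] -/
theorem map_eraseN1_cutKernel (m : ℕ) (c : Fin (3 + 3 * m) → Bool) :
    (SurfaceGroup.cutKernel c).map (eraseN1 m) =
      normalClosure (FreeGroup.of '' {j : Fin (3 + 3 * m) | c j ≠ cPat m 1 j}) := by
  rw [SurfaceGroup.cutKernel, map_normalClosure _ _ (eraseN1_surjective m), ← Set.range_comp]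
  -- the value of the erasure on the cut letter of `c` on handle `j`
  have hval : ∀ j : Fin (3 + 3 * m), c j ≠ cPat m 1 j →
      (eraseN1 m ∘ fun i : Fin (3 + 3 * m) => (PresentedGroup.of (i, c i) : S m)) j =
        if cPat m 1 j then (FreeGroup.of j)⁻¹ else FreeGroup.of j := by
    intro j hj
    simp only [Function.comp_apply]
    cases hc : cPat m 1 j
    · have hcj : c j = true := by
        cases h' : c j
        · exact absurd (h'.trans hc.symm) hj
        · rfl
      rw [hcj]
      exact eraseN1_b_of_eq_false m hc
    · have hcj : c j = false := by
        cases h' : c j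
        · rfl
        · exact absurd (h'.trans hc.symm) hj
      rw [hcj]
      exact eraseN1_a_of_eq_true m hc
  apply le_antisymm
  · refine normalClosure_le_normal ?_
    rintro _ ⟨j, rfl⟩
    by_cases hj : c j = cPat m 1 j
    · simp only [Function.comp_apply]
      rw [hj, eraseN1_of_cut]
      exact one_mem _
    · rw [hval j hj]
      split_ifs
      · exact inv_mem (subset_normalClosure ⟨j, hj, rfl⟩)
      · exact subset_normalClosure ⟨j, hj, rfl⟩
  · refine normalClosure_le_normal ?_
    rintro _ ⟨j, hj, rfl⟩
    have hmem : (eraseN1 m ∘ fun i : Fin (3 + 3 * m) => (PresentedGroup.of (i, c i) : S m)) j ∈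
        normalClosure (Set.range
          (eraseN1 m ∘ fun i : Fin (3 + 3 * m) => (PresentedGroup.of (i, c i) : S m))) :=
      subset_normalClosure ⟨j, rfl⟩
    rw [hval j hj] at hmem
    split_ifs at hmem
    · rw [SetLike.mem_coe, ← inv_inv (FreeGroup.of j)]
      exact inv_mem hmem
    · exact hmem

/-- **Lemma A, slot `2`**: the free shadow of the standard third kernel is the standard one,
`e N₂ = P₂ = ⟪xⱼ : j ≢ 2 (mod 3)⟫`. [folklore] -/
theorem map_eraseN1_N_two (m : ℕ) : (N m 2).map (eraseN1 m) = P2 (3 + 3 * m) := by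
  rw [N_eq_cutKernel, map_eraseN1_cutKernel, P2]
  congr 3
  ext j
  simp only [cPat, Fin.isValue, Fin.val_two, Fin.val_one, ne_eq, decide_eq_decide]
  omega

/-- **Lemma A, slot `0`**: the free shadow of the standard first kernel is the standard one,
`e N₀ = P₀ = ⟪xⱼ : j ≢ 0 (mod 3)⟫`. [folklore] -/
theorem map_eraseN1_N_zero (m : ℕ) : (N m 0).map (eraseN1 m) = P0 (3 + 3 * m) := by
  rw [N_eq_cutKernel, map_eraseN1_cutKernel, P0]
  congr 3
  ext j
  simp only [cPat, Fin.isValue, Fin.val_zero, Fin.val_one, ne_eq, decide_eq_decide]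
  omega

/-- The middle kernel dies under the erasure: `e N₁ = ⊥`. [folklore] -/
theorem map_eraseN1_N_one (m : ℕ) : (N m 1).map (eraseN1 m) = ⊥ := by
  rw [Subgroup.map_eq_bot_iff, ker_eraseN1]

/-! ## §2 The automorphism of the free group induced by an element of `Stab N₁` -/

/-- **Induced automorphism**: an automorphism `γ` of `S_{3+3m}` stabilising `N₁ = ker e` induces an
automorphism `θ` of `F_{3+3m}` through the erasure, `θ (e s) = e (γ s)` (first isomorphism theorem).
[folklore] -/
theorem exists_mulAut_eraseN1 (m : ℕ) (γ : S m ≃* S m)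
    (h : (N m 1).map γ.toMonoidHom = N m 1) :
    ∃ θ : MulAut (FreeGroup (Fin (3 + 3 * m))), ∀ s, θ (eraseN1 m s) = eraseN1 m (γ s) := by
  have hk : ((eraseN1 m).ker).map (γ : S m →* S m) = (eraseN1 m).ker := by
    rw [ker_eraseN1]
    exact h
  let q := QuotientGroup.quotientKerEquivOfSurjective (eraseN1 m) (eraseN1_surjective m)
  have hq : ∀ s, q (QuotientGroup.mk s) = eraseN1 m s := fun s => rfl
  refine ⟨(q.symm.trans (QuotientGroup.congr _ _ γ hk)).trans q, fun s => ?_⟩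
  rw [MulEquiv.trans_apply, MulEquiv.trans_apply,
    show q.symm (eraseN1 m s) = QuotientGroup.mk s from q.symm_apply_eq.2 (hq s).symm,
    QuotientGroup.congr_mk, hq]

/-! ## §3 Transversality and the read-back through the erasure -/

/-- **Transversality of the shadows of a gate triple**: if `K₀ = N₀`, `K₁ = N₁` and `π₁(K) = 1`
then `P₀ ⊔ e K₂ = ⊤` (map `⟪K₀ ∪ K₁ ∪ K₂⟫ = S` down the erasure: `e K₀ = P₀`, `e K₁ = 1`).
[folklore] -/
theorem P0_sup_map_eraseN1_eq_top (m : ℕ) (K : TrisectionKernels (3 + 3 * m))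
    (h0 : K 0 = N m 0) (h1 : K 1 = N m 1) (hs : Subsingleton K.tripleQuotient)
    (hK : (K 2).Normal) : P0 (3 + 3 * m) ⊔ (K 2).map (eraseN1 m) = ⊤ := by
  haveI : ((K 2).map (eraseN1 m)).Normal := hK.map _ (eraseN1_surjective m)
  have htop : normalClosure (⋃ i, (K i : Set (S m))) = ⊤ := QuotientGroup.subsingleton_iff.1 hs
  have hle : normalClosure (⋃ i, (K i : Set (S m))) ≤
      (P0 (3 + 3 * m) ⊔ (K 2).map (eraseN1 m)).comap (eraseN1 m) := by
    refine normalClosure_le_normal fun k hk => ?_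
    obtain ⟨i, hi⟩ := Set.mem_iUnion.1 hk
    rw [SetLike.mem_coe, mem_comap]
    fin_cases i
    · refine mem_sup_left ?_
      rw [← map_eraseN1_N_zero]
      refine mem_map_of_mem _ ?_
      rw [← h0]
      exact hi
    · have hk1 : eraseN1 m k = 1 := (mem_N_one_iff m k).1 (by rw [← h1]; exact hi)
      rw [hk1]
      exact one_mem _
    · exact mem_sup_right (mem_map_of_mem _ hi)
  rw [eq_top_iff]
  rintro w -
  obtain ⟨s, rfl⟩ := eraseN1_surjective m w
  exact hle (htop ▸ mem_top s)

/-- **Read-back through the erasure**: if `e L = v P₂` for a subgroup `L ≤ S` and `v ∈ Aut F` is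
induced by `x ∈ Aut S` with `x N₁ = N₁`, then `L ⊔ N₁ = x (N₂ ⊔ N₁)` (both sides contain
`N₁ = ker e` and have the same image `v P₂` under `e`). [folklore] -/
theorem sup_N_one_eq_map_of_map_eraseN1_eq (ℓ : ℕ) (L : Subgroup (S ℓ)) (x : S ℓ ≃* S ℓ)
    (v : MulAut (FreeGroup (Fin (3 + 3 * ℓ)))) (hx1 : (N ℓ 1).map x.toMonoidHom = N ℓ 1)
    (hx : ∀ s, eraseN1 ℓ (x s) = v (eraseN1 ℓ s))
    (hL : L.map (eraseN1 ℓ) = (P2 (3 + 3 * ℓ)).map v.toMonoidHom) :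
    L ⊔ N ℓ 1 = (N ℓ 2 ⊔ N ℓ 1).map x.toMonoidHom := by
  have hxe : (eraseN1 ℓ).comp x.toMonoidHom = v.toMonoidHom.comp (eraseN1 ℓ) :=
    MonoidHom.ext hx
  have hU : (L ⊔ N ℓ 1).map (eraseN1 ℓ) = (P2 (3 + 3 * ℓ)).map v.toMonoidHom := by
    rw [Subgroup.map_sup, hL, map_eraseN1_N_one, sup_bot_eq]
  have hV : ((N ℓ 2 ⊔ N ℓ 1).map x.toMonoidHom).map (eraseN1 ℓ) =
      (P2 (3 + 3 * ℓ)).map v.toMonoidHom := by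
    rw [map_map, hxe, ← map_map, Subgroup.map_sup, map_eraseN1_N_one, sup_bot_eq,
      map_eraseN1_N_two]
  calc L ⊔ N ℓ 1
      = ((L ⊔ N ℓ 1).map (eraseN1 ℓ)).comap (eraseN1 ℓ) := by
          rw [comap_map_eq, ker_eraseN1, sup_assoc, sup_idem]
    _ = (((N ℓ 2 ⊔ N ℓ 1).map x.toMonoidHom).map (eraseN1 ℓ)).comap (eraseN1 ℓ) := by
          rw [hU, hV]
    _ = (N ℓ 2 ⊔ N ℓ 1).map x.toMonoidHom := by
          rw [comap_map_eq, ker_eraseN1, sup_eq_left]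
          calc N ℓ 1 = (N ℓ 1).map x.toMonoidHom := hx1.symm
            _ ≤ (N ℓ 2 ⊔ N ℓ 1).map x.toMonoidHom := map_mono le_sup_right

/-! ## §4 The stub -/

/-- **STUB `stub_paddingTransfer`** (registered signature, verbatim): gate ascent, free padding,
the Goeritz realisation of the padding moves and the stabilised erasure together give Goeritz
padding — after `m + 1` stabilisations the `(1,2)` pair closure `K₂' N₁'` of a gate triple is the
image of the standard one under an element of `Stab N₀' ∩ Stab N₁'`. [folklore] -/
theorem stub_paddingTransfer : PaddingTransfer := by
  intro hGA hFP hMG hES m K hK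
  have hK' : InGate (m + (m + 1)) ((K.stabilizeIter (m + 1)).cast (level_add m (m + 1))) :=
    hGA m K (m + 1) hK
  obtain ⟨h0, h1, hs, -, γ, hc1, hc2⟩ := hK
  -- `K₂ = γ N₂` is normal
  have hK2 : (K 2).Normal := by
    rw [← hc2]
    exact (normal_N m 2).map _ γ.surjective
  -- the induced automorphism `θ` of `F_{3+3m}` and the free shadow `Q = e K₂ = θ P₂`
  obtain ⟨θ, hθ⟩ := exists_mulAut_eraseN1 m γ hc1
  have hθe : (eraseN1 m).comp γ.toMonoidHom = θ.toMonoidHom.comp (eraseN1 m) :=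
    MonoidHom.ext fun s => (hθ s).symm
  have hQ : (K 2).map (eraseN1 m) = (P2 (3 + 3 * m)).map θ.toMonoidHom := by
    rw [← hc2, map_map, hθe, ← map_map, map_eraseN1_N_two]
  -- transversality, free padding, Goeritz realisation of the padding product
  have htr : P0 (3 + 3 * m) ⊔ (P2 (3 + 3 * m)).map θ.toMonoidHom = ⊤ := by
    rw [← hQ]
    exact P0_sup_map_eraseN1_eq_top m K h0 h1 hs hK2
  obtain ⟨v, hvm, hv⟩ := hFP m θ htr
  have hvG : v ∈ goeritzInduced (m + (m + 1)) :=
    (closure_le _).2 (fun φ hφ => hMG (m + (m + 1)) φ hφ) hvm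
  obtain ⟨x, hx0, hx1, hx⟩ := hvG
  -- the stabilised erasure, read back in `S`
  have hE := hES m (m + 1) K hK2
  rw [hQ, ← hv] at hE
  exact ⟨m + 1, x, hK', hx0, hx1,
    sup_N_one_eq_map_of_map_eraseN1_eq (m + (m + 1)) _ x v hx1 hx hE⟩

end Summit.SmoothPoincare4.SmoothPoincare4.Theorems.NormalFormStablyTrivial.Luft

end
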